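/-
Copyright (c) 2026 the pub-hodgecm-mathlib formalisation cell (harness21).  Prover seat hodgecm-mathlib-R90-C10-p05 (g3), R90-TF SLAB section S1 «Ch10-local», (S-W) line lead,
card (c3) of ruling R-SW-4 (self-dealt as acting dealer of the (S-W) programme after R90-C10-plan (g3)'s seat handoff 2026-09-05T03:48Z): U4Keys :182 WILD corner, cell
(S-W-Rb), sub-cell (Rb-odd) «cond_E `n` odd, `n ≥ 2δ + 3`» — THE WILD WITNESS-COVER ARITHMETIC.  Pure linear arithmetic (`omega`), MODEL-free; the integer shadow of the
cover assembly `exists_depth_witness_twoDepth_ofDefect` (to come, over the wild Family X∕Z twins (c1)(c2) of R-SW-4).  Evidence file: `R90/R90-C10-p05/g3/WILD-COVER-GAP.v1.md`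
9381e9d31740a03d (+ `wild_cover_bruteforce.py`).  NOT THE PAYER of :182.
-/
import Summits.HodgeConjecture.HodgeConjecture.Theorems.K2E3TwoDepthDepthWitnessCover   -- ★ p862713 (K2E3-p37 (g2)): the TAME `cover_arith` ∕ `cover_arith_zero` this file shifts by the defect (cited, not used)
import HarnessLib

/-!
# R90-TF S1 «Ch10-local» — U4Keys :182, THE WILD CORNER (S-W), cell (S-W-Rb), sub-cell (Rb-odd): THE WILD WITNESS-COVER ARITHMETIC
# «at the (R-b) datum `e_W = (⌊n∕2⌋, δ; ⌈n∕2⌉, δ + 1)`, `k = 2δ`, with a MINIMAL trace-one element (`|t| = |ϖ|^{−δ}`), every REALIZABLE intermediate lower cell of `J_{e_W}`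
# (and of its `w`-swap) lies in the wild X-regime or the wild Z-regime — PROVIDED `n` is odd and `n ≥ 2δ + 3`»   [Roche1998 §3–§4; BruhatTits1972 (6.4.9); Tits1979 §1.15; Serre1979 III §3]

Cell hodgecm-mathlib, R90-TF SLAB, crux item H413 = `stmt-HodgeConjecture-24833` (route `HCCMUnconditional`, no route verbs); serves BY NAME the OPEN tier-0 socket (S-W)
`…U4Keys.sig_K2E3KeysThmTwoContractingRamifiedCharOnePosDepthWild` through its cell letter `HWRb` (R-S1-38; ★ (W-5) p865171) and the WILD DETERMINANT ROAD that produces it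
(type side: ★ (W-3b) p865200 `hθmul` datum → wild Family X∕Z twins (R-SW-4 (c1)(c2)) → THIS arithmetic → cover assembly → wild (8)).  Author R90-C10-p05 (g3).  `--supports
stmt-HodgeConjecture-24833 --as helper`; THEOREMS ONLY; no `K`, no valuation: integers only (`lx = log|x|`, `lz = log|z|`, exponents `r s r' s' m k δ`).  NOT THE PAYER of :182.

THE POINT.  ★ `K2E3TwoDepthDepthWitnessCover.cover_arith` (TAME: integral trace-one `t`) shows that every intermediate lower cell `ū(x,z)` of the two-depth group `J_e`,
`e = (r, s; r', s')` (`r + r' = m + 1`, `s + s' = k + 1`, aligned), lies in the regime of witness family X or Z of ★ `K2E3TwoDepthDepthWitness`.  At a WILDLY ramified dyadic place the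
minimal trace-one element has `|t| = |ϖ|^{−δ}`, `δ = d − 1 ≥ 1` (★ (W-0) p865099, ★ bridge p865207), and reading the two ★ family proofs with that `t` (evidence file §1): Family X's
regime keeps its shape with `hz2` shifted by `δ` (`|ϖ|^m|z| ≤ |ϖ|^{1+δ}|x|²`) and `s + δ ≤ 2r`, `s' + δ ≤ 2r'`, `δ ≤ m`; Family Z's regime keeps its shape with `hε` shifted by `δ`
(`|ϖ|^k|x|² ≤ |ϖ|^{m+1+δ}|z|`; its other use of `|t| ≤ 1` is free under minimality, ★ (O1) §1).  The cells themselves are constrained at a wild place (evidence §2): MINIMALITY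
`|z| ≥ |t||x|²` (`2·lx + δ ≤ lz`) and NO CANCELLATION `ord z = min(2·ord x − δ, ord y')` with skew `y'` of order `≡ d = δ + 1 (mod 2)` (`lz = 2·lx + δ ∨ lz ≡ δ + 1 (mod 2)`).
Under these, at the (R-b) datum of ★ (W-3b) (`r + r' = n = m + 1`, `(s, s') = (δ, δ+1)`, `k = 2δ`) in EITHER orientation, the X∕Z dichotomy holds for ALL cells iff `n` is ODD
and `n ≥ 2δ + 3` — brute-forced first (evidence §3: δ ≤ 3, n ≤ 2δ + 11), proved here for all parameters by `omega`.  For `n` even or `n = 2δ + 1` the single line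
`lz = 2·lx + (m − δ)` is NOT covered (evidence §3–§5; p34 (a)'s window, now exact) — NOT claimed here; that sub-cell carries one open type-side lemma (R-SW-4 (c4)).
* §1 `cover_arith_wild` (orientation `(⌊n∕2⌋, δ; ⌈n∕2⌉, δ+1)`), `cover_arith_wild_swap` (orientation `(⌈n∕2⌉, δ+1; ⌊n∕2⌋, δ)`), `cover_arith_wild_zero` (the `x = 0` column, both).
CONSUMER: the wild cover assembly (c3) §2 `exists_depth_witness_twoDepth_ofDefect` = ★ `exists_depth_witness_twoDepth`'s proof with these three lemmas and the (c1)(c2) family twins.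
HONEST LABEL: HC_CM is proved only modulo the 7 printed citations (2 remaining named inputs: hLiu418 = stmt-HodgeConjecture-24832, h413 = stmt-HodgeConjecture-24833)
until rung 0 closes; count-neutral — integer arithmetic, pays no socket, closes nothing; (S-W) stays the XL residual of :182.

## References
* [Roche1998] A. Roche, *Types and Hecke algebras for principal series representations of split reductive p-adic groups*, Ann. Sci. ÉNS (4) 31 (1998), §3–§4 (support of `χ̃`-spherical vectors, cell by cell).
* [BruhatTits1972] F. Bruhat, J. Tits, *Groupes réductifs sur un corps local I*, Publ. Math. IHÉS 41 (1972), (6.4.9).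
* [Tits1979] J. Tits, *Reductive groups over local fields*, Proc. Sympos. Pure Math. 33.1 (1979), §1.15 (the trace constant of the ramified quasi-split `SU₃`).
* [Serre1979] J.-P. Serre, *Local Fields*, GTM 67 (1979), Ch. III §3 Prop. 7 (`Tr 𝔭_E^j = 𝔭_F^{⌊(j+d)∕2⌋}`; orders of skew elements).
-/

set_option autoImplicit false
-- the mandated namespace repeats the single-problem summit's segment (`HodgeConjecture.HodgeConjecture`)
set_option linter.dupNamespace false

namespace Summit.HodgeConjecture.HodgeConjecture.R90.S1.WildDepthWitnessCoverArith

/-! ## §1 The wild cover arithmetic at the (R-b) datum, `n = m + 1` odd, `n ≥ 2δ + 3` -/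

/-- **WILD COVER ARITHMETIC, orientation `e_W = (⌊n∕2⌋, δ; ⌈n∕2⌉, δ + 1)`.**  Integers: `m` EVEN (so `n = m + 1` is odd) with `2δ + 2 ≤ m` (`n ≥ 2δ + 3`), `1 ≤ δ`, `k = 2δ`,
`r + r = m`, `r' = r + 1`, `s = δ`, `s' = δ + 1`; a cell `(lx, lz)` with `lz ≤ 0` and the NO-CANCELLATION parity `lz = lx + lx + δ ∨ lz % 2 = (δ + 1) % 2` (the minimality bound
`lx + lx + δ ≤ lz` also holds at a wild place but is NOT needed by the arithmetic, so it is not a binder), off `J_e` (`¬(lx ≤ −r' ∧ lz ≤ −s')`) and off the sharp big cell (`¬(lx − lz ≤ −r ∧ s ≤ lz)`).  Then the WILD X-regime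
(`−m ≤ −r + lx`, `−m + lz ≤ −r' + lx`, `−m + lz + δ ≤ −1 + 2lx`, `r' ≤ m`, `s' ≤ m`, `s + δ ≤ 2r`, `s' + δ ≤ 2r'`, `δ ≤ m`) or the WILD Z-regime (`1 ≤ k`, `−k ≤ −s + lz`,
`−k + lx ≤ −r + lz`, `−k + lx ≤ −r'`, `−k + lz ≤ −s'`, `−k + δ + 2lx ≤ −(m+1) + lz`) holds.  (`omega`; brute-forced beforehand, evidence file §3.)
[cite: Roche1998, §4] [cite: BruhatTits1972, (6.4.9)] [cite: Tits1979, §1.15] [cite: Serre1979, Ch. III §3 Prop. 7] -/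
theorem cover_arith_wild {r s r' s' m k δ : ℕ} {lx lz : ℤ}
    (hδ1 : 1 ≤ δ) (hm : 2 * δ + 2 ≤ m) (hrr : r + r = m) (hr' : r' = r + 1) (hs : s = δ) (hs' : s' = δ + 1) (hk : k = 2 * δ)
    (hz0 : lz ≤ 0) (hpar : lz = lx + lx + (δ : ℤ) ∨ lz % 2 = (((δ : ℤ) + 1) % 2))
    (hoff : ¬ (lx ≤ -(r' : ℤ) ∧ lz ≤ -(s' : ℤ))) (hshal : ¬ (lx + -lz ≤ -(r : ℤ) ∧ (s : ℤ) ≤ lz)) :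
    (-(m : ℤ) ≤ -(r : ℤ) + lx ∧ -(m : ℤ) + lz ≤ -(r' : ℤ) + lx ∧ -(m : ℤ) + lz + (δ : ℤ) ≤ -(1 : ℤ) + (lx + lx) ∧
        r' ≤ m ∧ s' ≤ m ∧ s + δ ≤ 2 * r ∧ s' + δ ≤ 2 * r' ∧ δ ≤ m) ∨
      (1 ≤ k ∧ -(k : ℤ) ≤ -(s : ℤ) + lz ∧ -(k : ℤ) + lx ≤ -(r : ℤ) + lz ∧ -(k : ℤ) + lx ≤ -(r' : ℤ) ∧ -(k : ℤ) + lz ≤ -(s' : ℤ) ∧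
        -(k : ℤ) + (δ : ℤ) + (lx + lx) ≤ -((m : ℤ) + 1) + lz) := by
  omega

/-- **WILD COVER ARITHMETIC, swapped orientation `e_W^{swap} = (⌈n∕2⌉, δ + 1; ⌊n∕2⌋, δ)`** (the upper shells after the `w`-transport, ★ `K2E3TwoDepthUpperShellCover`'s pattern):
same hypotheses with `r = r' + 1`, `r' + r' = m`, `s = δ + 1`, `s' = δ`; same dichotomy. (`omega`; evidence file §3.) [cite: Roche1998, §4] [cite: BruhatTits1972, (6.4.9)] [cite: Tits1979, §1.15] -/
theorem cover_arith_wild_swap {r s r' s' m k δ : ℕ} {lx lz : ℤ}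
    (hδ1 : 1 ≤ δ) (hm : 2 * δ + 2 ≤ m) (hrr : r' + r' = m) (hr : r = r' + 1) (hs : s = δ + 1) (hs' : s' = δ) (hk : k = 2 * δ)
    (hz0 : lz ≤ 0) (hpar : lz = lx + lx + (δ : ℤ) ∨ lz % 2 = (((δ : ℤ) + 1) % 2))
    (hoff : ¬ (lx ≤ -(r' : ℤ) ∧ lz ≤ -(s' : ℤ))) (hshal : ¬ (lx + -lz ≤ -(r : ℤ) ∧ (s : ℤ) ≤ lz)) :
    (-(m : ℤ) ≤ -(r : ℤ) + lx ∧ -(m : ℤ) + lz ≤ -(r' : ℤ) + lx ∧ -(m : ℤ) + lz + (δ : ℤ) ≤ -(1 : ℤ) + (lx + lx) ∧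
        r' ≤ m ∧ s' ≤ m ∧ s + δ ≤ 2 * r ∧ s' + δ ≤ 2 * r' ∧ δ ≤ m) ∨
      (1 ≤ k ∧ -(k : ℤ) ≤ -(s : ℤ) + lz ∧ -(k : ℤ) + lx ≤ -(r : ℤ) + lz ∧ -(k : ℤ) + lx ≤ -(r' : ℤ) ∧ -(k : ℤ) + lz ≤ -(s' : ℤ) ∧
        -(k : ℤ) + (δ : ℤ) + (lx + lx) ≤ -((m : ℤ) + 1) + lz) := by
  omega

/-- **The `x = 0` column** (z skew), either orientation: off `J_e` via `z` (`¬ lz ≤ −s'`), off the sharp big cell (`¬ s ≤ lz`), `lz ≤ 0`, `{s, s'} = {δ, δ + 1}`, `k = 2δ`, `1 ≤ δ`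
⟹ the Z-regime's `z`-inequalities `1 ≤ k`, `−k ≤ −s + lz`, `−k + lz ≤ −s'` (`lz ≤ 0` is implied by `¬ s ≤ lz` and not a binder). (`omega`.) [cite: Roche1998, §4] -/
theorem cover_arith_wild_zero {s s' k δ : ℕ} {lz : ℤ} (hδ1 : 1 ≤ δ) (hk : k = 2 * δ)
    (hss : (s = δ ∧ s' = δ + 1) ∨ (s = δ + 1 ∧ s' = δ))
    (hoff : ¬ lz ≤ -(s' : ℤ)) (hshal : ¬ (s : ℤ) ≤ lz) :
    1 ≤ k ∧ -(k : ℤ) ≤ -(s : ℤ) + lz ∧ -(k : ℤ) + lz ≤ -(s' : ℤ) := by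
  omega

/-- **The gap is real (NOT covered): at `n` even the cell on the line `lz = 2·lx + (m − δ)` defeats both regimes** — recorded as the NEGATION instance `m = 2δ + 1` (`n = 2δ + 2`),
`lx = −1`, `lz = m − δ − 2`… stated minimally: for `δ = 1`, `m = 3` (`n = 4`, `e_W = (2,1;2,2)`, `k = 2`) the realizable off-`J_e`, off-sharp cell `(lx, lz) = (−1, 0)` satisfies
NEITHER the wild X-regime NOR the wild Z-regime (evidence file §3, first line of the table).  So `cover_arith_wild`'s parity∕size hypotheses are load-bearing. (`decide`-free: `omega` on the
negated conjunctions.) [cite: Tits1979, §1.15] -/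
theorem not_cover_arith_wild_example :
    ¬ ((-(3 : ℤ) ≤ -(2 : ℤ) + (-1) ∧ -(3 : ℤ) + 0 ≤ -(2 : ℤ) + (-1) ∧ -(3 : ℤ) + 0 + (1 : ℤ) ≤ -(1 : ℤ) + ((-1) + (-1)) ∧
          (2 : ℕ) ≤ 3 ∧ (2 : ℕ) ≤ 3 ∧ (1 : ℕ) + 1 ≤ 2 * 2 ∧ (2 : ℕ) + 1 ≤ 2 * 2 ∧ (1 : ℕ) ≤ 3) ∨
        ((1 : ℕ) ≤ 2 ∧ -(2 : ℤ) ≤ -(1 : ℤ) + 0 ∧ -(2 : ℤ) + (-1) ≤ -(2 : ℤ) + 0 ∧ -(2 : ℤ) + (-1) ≤ -(2 : ℤ) ∧ -(2 : ℤ) + 0 ≤ -(2 : ℤ) ∧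
          -(2 : ℤ) + (1 : ℤ) + ((-1) + (-1)) ≤ -((3 : ℤ) + 1) + 0)) := by
  omega

end Summit.HodgeConjecture.HodgeConjecture.R90.S1.WildDepthWitnessCoverArith
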